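import Literature.AlgebraicGeometry.Motives.HodgeStructureEndActionBlockDimensionNonsplit
import Mathlib.LinearAlgebra.Charpoly.ToMatrix
import Mathlib.LinearAlgebra.Charpoly.BaseChange
import Mathlib.LinearAlgebra.Matrix.Trace
import HarnessLib

/-!
# Milne 1999, proof of Proposition 2.1 ON `K`-POINTS: «`P_{A,α}(X) = ∏ᵢ P_{Lᵢ/k,α}(X)^{mᵢ}`, all `mᵢ = m`» — for EVERY field `K ⊇ ℚ`
# and EVERY `u ∈ K ⊗_ℚ F`: `P(ι_K(u) | K ⊗ V) = P(u | K ⊗_ℚ F)^d`, `tr_K ι_K(u) = d · Tr_{(K ⊗ F)/K}(u)`,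
# `det ι_K(u) = N_{(K ⊗ F)/K}(u)^d`, `d = dim_ℚ V/[F:ℚ]`; «`P_{A,α}` … is equal to the characteristic polynomial of `V(α)` acting
# on the `k`-vector space `V(A)`»: `P((ι a)_K) = P_{F/ℚ}(a)^d` read in `K[X]` (§2 Prop. 2.1 p. 647 L24–L36)

[topic AlgebraicGeometry/Motives]

Layer `Literature/AlgebraicGeometry/Motives`, lane `lit-hodgefound` (Track 2 foundations library; prover seat
`lit-hodgefound-p02`, generation 56, self-proposed row g56-#15; theme «`C₀ ⊗ k` and its factor fields along a field
extension»; sequel of g56-#13 `Motives/HodgeStructureEndActionBlockDimensionNonsplit`). THEOREMS ONLY: no definition, no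
named fact (net debt `0`), no instance, no notation.

Milne proves Proposition 2.1 through characteristic polynomials: «`P_{L/ℚ,α}(X) = ∏ᵢ P_{Lᵢ/k,α}(X)`» and «from the
isomorphism of `L ⊗_ℚ k`-modules `V(A) ≈ ⊕ Lᵢ^{mᵢ}` we find that `P_{A,α}(X) = ∏ P_{Lᵢ/k,α}(X)^{mᵢ}`», all `mᵢ = m`.  The tree
has the RATIONAL statement for `α ∈ F` (`EndAction.charpoly_ι : P(ι(a) | V) = P_{F/ℚ}(a)^d`, `trace_ι`, `det_ι`, Shimura §5.1
Prop. 2, in `Motives/HodgeStructureEndActionCharpoly`).  Here, on `K`-POINTS for EVERY field `K ⊇ ℚ` and for EVERY element `u` of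
the `K`-algebra `K ⊗_ℚ F = ∏ Fᵢ` (not only `u = 1 ⊗ a`): since `K ⊗ V ≅ (K ⊗ F)^d` as a `(K ⊗ F)`-module (g20/g56-#13, the
bijection `Ψ`), `ι_K(u)` is conjugate to the diagonal action of `u·` on `(K ⊗ F)^d`, whence
**`P(ι_K(u) | K ⊗ V) = P(u· | K ⊗_ℚ F)^d`**, **`tr_K ι_K(u) = d · Tr_{(K ⊗ F)/K}(u)`**, **`det_K ι_K(u) = N_{(K ⊗ F)/K}(u)^d`**
(`d = dim_ℚ V/[F:ℚ]`); and for `u = 1 ⊗ a`: `P(u· | K ⊗ F) = P_{F/ℚ}(a)` mapped to `K[X]` (Mathlib `Algebra.baseChange_lmul`,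
`LinearMap.charpoly_baseChange`), so `P((ι a)_K | K ⊗ V) = P_{F/ℚ}(a)^d` in `K[X]` — «`P_{A,α}` … is equal to the characteristic
polynomial of `V(α)` acting on the `k`-vector space `V(A)`», consistently with the rational `charpoly_ι`.

## The source, verbatim

J. S. Milne, *Lefschetz classes on abelian varieties*, Duke Math. J. **96** (1999) 639–675 [Milne1999LefschetzClasses]
(held `paper:doi-10-1215-s0012-7094-99-09620-5`; Duke page = folio + 638). §2 p. 647 (p0009) L14–L36: «**Proposition 2.1.**
Let `A` be an abelian variety, and let `L` be a subfield of `End⁰(A)` containing the identity map. Then `V(A)` is a free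
`L ⊗_ℚ k`-module of rank `2 dim A/[L : ℚ]`. Proof. … Let `α ∈ L`. The characteristic polynomial `P_{A,α}(X)` of `α` as an
endomorphism of `A` is monic of degree `2 dim A` with coefficients in `ℚ`, and it is equal to the characteristic polynomial of
`V(α)` acting on the `k`-vector space `V(A)` (see the appendix). From the decomposition `L ⊗_ℚ k = ∏ Lᵢ` we find that
`P_{L/ℚ,α}(X) = ∏ᵢ P_{Lᵢ/k,α}(X)` where `P_{L/ℚ,α}(X)` (resp. `P_{Lᵢ/k,α}(X)`) denotes the characteristic polynomial of `α` in the
field extension `L/ℚ` (resp. `Lᵢ/k`). From the isomorphism of `L ⊗_ℚ k`-modules `V(A) ≈ ⊕ Lᵢ^{mᵢ}` we find that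
`P_{A,α}(X) = ∏ P_{Lᵢ/k,α}(X)^{mᵢ}`.»
G. Shimura, *Abelian Varieties with Complex Multiplication and Modular Functions* (1998) [Shimura1998], §5.1 Prop. 2:
«`tr(α) = m Tr(α)`, `ν(α) = N(α)^m`» (the rational case, tree `EndAction.trace_ι` / `det_ι`).

## What is PROVED

* §0 (generic folklore, private — as in the tree's `Literature/RingTheory/SimpleModule/SimpleAlgebraActionCharpoly`):
  `P(c ↦ φ ∘ c on Sᵐ) = P(φ)ᵐ`, `tr = m · tr(φ)`, `det = det(φ)ᵐ` (block-diagonal matrix `diag(φ, …, φ)`).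
* §1 **`charpoly_lmul_one_tmul`** (`P(1 ⊗ a · | K ⊗_ℚ F) = P_{F/ℚ}(a)` mapped to `K[X]`).
* §2 (namespace `….HodgeStructure.EndAction`) **`charpoly_baseChangeAction`** (`P(ι_K(u)) = P(u· | K ⊗ F)^d`),
  **`trace_baseChangeAction`** (`tr ι_K(u) = d · Tr_{(K ⊗ F)/K}(u)`), **`det_baseChangeAction`** (`det ι_K(u) = N_{(K ⊗ F)/K}(u)^d`),
  **`charpoly_baseChange_ι`** (`P((ι a)_K) = (P_{F/ℚ}(a) ↦ K[X])^d`), `charpoly_baseChange_ι'` (`= P(ι a) ↦ K[X]`, Mathlib),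
  **`charpoly_ι_map`** (the rational identity `P(ι a) = P_{F/ℚ}(a)^d` recovered in `K[X]` from the `K ⊗ F`-route).

NOT here: Milne's appendix (comparison of `P_{A,α}` with the Weil-cohomology characteristic polynomial — on the present
carrier `V(A) = K ⊗ V` HAS the `ℚ`-structure `V`); the factorization `P(u· | K ⊗ F) = ∏ᵢ P(u eᵢ · | Fᵢ)` over the factor fields.

Nearest tree results, BY NAME: `EndAction.charpoly_ι`, `trace_ι`, `det_ι` (`Motives/HodgeStructureEndActionCharpoly`, rational);
g56-#13 `EndAction.baseChange_apply_ι_mul`, g20 `EndAction.exists_bijective_sum_baseChange_apply_ι`; `trace_baseChange_one_tmul`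
(`Motives/HodgeStructureLefschetzGroupTraceTransfer`); Mathlib `LinearEquiv.charpoly_conj`, `LinearMap.trace_conj'`, `LinearMap.det_conj`,
`Matrix.det_blockDiagonal`, `Matrix.trace_blockDiagonal`, `LinearMap.charpoly_baseChange`, `Algebra.baseChange_lmul`.

## References

* [Milne1999LefschetzClasses] J. S. Milne, *Lefschetz classes on abelian varieties*, Duke Math. J. 96 (1999) 639–675, §2
  Prop. 2.1 and its proof (p. 647 L14–L36).
* [Shimura1998] G. Shimura, *Abelian Varieties with Complex Multiplication and Modular Functions*, Princeton (1998), §5.1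
  Proposition 2.
-/

noncomputable section

open scoped TensorProduct

namespace Literature.AlgebraicGeometry.Motives

/-! ## §0 Folklore: the diagonal action `c ↦ φ ∘ c` on `Fin m → S` — characteristic polynomial, trace, determinant -/

section Diagonal

universe uK uS

variable {K : Type uK} [CommRing K] {S : Type uS} [AddCommGroup S] [Module K S]

/-- The characteristic polynomial of a block-diagonal matrix is the product of those of the blocks. [folklore] -/
private theorem charpoly_blockDiagonal₅₇₆ {m o : Type*} [Fintype m] [DecidableEq m] [Fintype o] [DecidableEq o]
    (N : o → Matrix m m K) : (Matrix.blockDiagonal N).charpoly = ∏ l, (N l).charpoly := by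
  have h : (Matrix.blockDiagonal N).charmatrix = Matrix.blockDiagonal fun l => (N l).charmatrix := by
    ext ⟨i, l⟩ ⟨j, l'⟩
    simp only [Matrix.charmatrix_apply, Matrix.blockDiagonal_apply, Matrix.diagonal_apply, Prod.mk.injEq]
    by_cases hl : l = l'
    · subst hl
      by_cases hij : i = j
      · subst hij; simp
      · simp [hij]
    · simp [hl]
  unfold Matrix.charpoly
  rw [h, Matrix.det_blockDiagonal]

/-- In the basis of `Fin m → S` built from a basis of `S`, `c ↦ φ ∘ c` has the block-diagonal matrix `diag(φ, …, φ)`. [folklore] -/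
private theorem toMatrix_compLeft₅₇₆ {σ : Type*} [Fintype σ] [DecidableEq σ] (b : Module.Basis σ K S) (φ : S →ₗ[K] S)
    (m : ℕ) :
    LinearMap.toMatrix
        ((Pi.basis fun _ : Fin m => b).reindex ((Equiv.sigmaEquivProd (Fin m) σ).trans (Equiv.prodComm (Fin m) σ)))
        ((Pi.basis fun _ : Fin m => b).reindex ((Equiv.sigmaEquivProd (Fin m) σ).trans (Equiv.prodComm (Fin m) σ)))
        (φ.compLeft (Fin m)) =
      Matrix.blockDiagonal fun _ : Fin m => LinearMap.toMatrix b b φ := by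
  ext ⟨i, l⟩ ⟨j, l'⟩
  simp only [LinearMap.toMatrix_apply, Module.Basis.repr_reindex_apply, Module.Basis.reindex_apply,
    Equiv.symm_trans_apply, Equiv.prodComm_symm, Equiv.prodComm_apply, Prod.swap_prod_mk,
    Equiv.sigmaEquivProd_symm_apply, Pi.basis_apply, Pi.basis_repr, Matrix.blockDiagonal_apply,
    LinearMap.compLeft_apply, Function.comp_apply]
  by_cases hl : l = l'
  · subst hl
    simp
  · rw [if_neg hl, Pi.single_eq_of_ne hl, map_zero, map_zero, Finsupp.zero_apply]

variable [Module.Free K S] [Module.Finite K S]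

/-- `charpoly(c ↦ φ ∘ c on Sᵐ) = charpoly(φ)ᵐ`. [folklore] -/
private theorem charpoly_compLeft_eq_pow₅₇₆ [Nontrivial K] (φ : S →ₗ[K] S) (m : ℕ) :
    (φ.compLeft (Fin m)).charpoly = φ.charpoly ^ m := by
  classical
  let b := Module.Free.chooseBasis K S
  rw [← LinearMap.charpoly_toMatrix _ ((Pi.basis fun _ : Fin m => b).reindex
      ((Equiv.sigmaEquivProd (Fin m) _).trans (Equiv.prodComm (Fin m) _))),
    toMatrix_compLeft₅₇₆, charpoly_blockDiagonal₅₇₆, Finset.prod_const, Finset.card_univ, Fintype.card_fin,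
    LinearMap.charpoly_toMatrix]

/-- `tr(c ↦ φ ∘ c on Sᵐ) = m · tr(φ)`. [folklore] -/
private theorem trace_compLeft_eq_nsmul₅₇₆ (φ : S →ₗ[K] S) (m : ℕ) :
    LinearMap.trace K (Fin m → S) (φ.compLeft (Fin m)) = m • LinearMap.trace K S φ := by
  classical
  let b := Module.Free.chooseBasis K S
  rw [LinearMap.trace_eq_matrix_trace K ((Pi.basis fun _ : Fin m => b).reindex
      ((Equiv.sigmaEquivProd (Fin m) _).trans (Equiv.prodComm (Fin m) _))),
    toMatrix_compLeft₅₇₆, Matrix.trace_blockDiagonal, Finset.sum_const, Finset.card_univ, Fintype.card_fin,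
    LinearMap.trace_eq_matrix_trace K b]

/-- `det(c ↦ φ ∘ c on Sᵐ) = det(φ)ᵐ`. [folklore] -/
private theorem det_compLeft_eq_pow₅₇₆ (φ : S →ₗ[K] S) (m : ℕ) :
    LinearMap.det (φ.compLeft (Fin m)) = LinearMap.det φ ^ m := by
  classical
  let b := Module.Free.chooseBasis K S
  rw [← LinearMap.det_toMatrix ((Pi.basis fun _ : Fin m => b).reindex
      ((Equiv.sigmaEquivProd (Fin m) _).trans (Equiv.prodComm (Fin m) _))),
    toMatrix_compLeft₅₇₆, Matrix.det_blockDiagonal, Finset.prod_const, Finset.card_univ, Fintype.card_fin,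
    LinearMap.det_toMatrix]

end Diagonal

/-! ## §1 `P(u | F ⊗ k)` for `u = 1 ⊗ a` is `P_{F/ℚ}(a)` read in `K` -/

section Scalars

universe uK uF

variable (K : Type uK) [Field K] [Algebra ℚ K] (F : Type uF) [Field F] [NumberField F]

/-- **`P(1 ⊗ a · | K ⊗_ℚ F) = P_{F/ℚ}(a)` READ IN `K[X]`**: multiplication by `1 ⊗ a` on `K ⊗_ℚ F` is the base change of
multiplication by `a` on `F` (Mathlib `Algebra.baseChange_lmul`, `LinearMap.charpoly_baseChange`) — «`P_{L/ℚ,α}(X) = ∏ᵢ P_{Lᵢ/k,α}(X)`»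
before splitting into factors. [cite: Milne1999LefschetzClasses, §2 Prop. 2.1 proof, p. 647 L28–L33] -/
theorem charpoly_lmul_one_tmul (a : F) :
    (Algebra.lmul K (K ⊗[ℚ] F) ((1 : K) ⊗ₜ[ℚ] a)).charpoly = (Algebra.lmul ℚ F a).charpoly.map (algebraMap ℚ K) := by
  rw [← Algebra.baseChange_lmul, LinearMap.charpoly_baseChange]

end Scalars

namespace HodgeStructure

namespace EndAction

universe v uK

variable {V : Type v} [AddCommGroup V] [Module ℚ V] {n : ℤ} {H : HodgeStructure V n}
variable {F : Type*} [Field F] [NumberField F]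
variable (K : Type uK) [Field K] [Algebra ℚ K] (A : EndAction H F) [Module.Finite ℚ V]

/-- `ι_K(u)` is conjugate, along g20's `(K ⊗ F)`-linear `Ψ : (K ⊗ F)^d ≅ K ⊗ V` (g56-#13 `baseChange_apply_ι_mul`), to the
diagonal action of `u·` on `(K ⊗ F)^d` — «the isomorphism of `L ⊗_ℚ k`-modules `V(A) ≈ ⊕ Lᵢ^{mᵢ}`».
[cite: Milne1999LefschetzClasses, §2 Prop. 2.1 proof, p. 647 L34–L36] -/
private theorem exists_conj_compLeft₅₇₆ :
    ∃ (d : ℕ) (Ψ : (Fin d → K ⊗[ℚ] F) ≃ₗ[K] K ⊗[ℚ] V), d * Module.finrank ℚ F = Module.finrank ℚ V ∧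
      ∀ u : K ⊗[ℚ] F, baseChangeAction K A.ι u = Ψ.conj ((LinearMap.mulLeft K u).compLeft (Fin d)) := by
  classical
  obtain ⟨d, v, hd, hbij⟩ := A.exists_bijective_sum_baseChange_apply_ι K
  let θ : Fin d → (K ⊗[ℚ] F →ₗ[K] K ⊗[ℚ] V) := fun j => (LinearMap.applyₗ (v j) ∘ₗ A.ι.toLinearMap).baseChange K
  let Ψₗ : (Fin d → K ⊗[ℚ] F) →ₗ[K] K ⊗[ℚ] V := ∑ j, θ j ∘ₗ LinearMap.proj j
  have hΨ : ∀ c, Ψₗ c = ∑ j, θ j (c j) := fun c => by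
    simp only [Ψₗ, LinearMap.sum_apply, LinearMap.comp_apply, LinearMap.proj_apply]
  have hbijₗ : Function.Bijective Ψₗ :=
    ⟨fun a b h => hbij.1 (show (∑ j, θ j (a j)) = ∑ j, θ j (b j) by rw [← hΨ, ← hΨ]; exact h),
      fun y => (hbij.2 y).imp fun c hc => (hΨ c).trans hc⟩
  let Ψ : (Fin d → K ⊗[ℚ] F) ≃ₗ[K] K ⊗[ℚ] V := LinearEquiv.ofBijective Ψₗ hbijₗ
  have hΨapply : ∀ c, Ψ c = ∑ j, θ j (c j) := hΨ
  have hΨsmul : ∀ (u : K ⊗[ℚ] F) (c : Fin d → K ⊗[ℚ] F), Ψ (u • c) = baseChangeAction K A.ι u (Ψ c) := by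
    intro u c
    rw [hΨapply, hΨapply, map_sum]
    exact Finset.sum_congr rfl fun j _ => A.baseChange_apply_ι_mul K (v j) u (c j)
  refine ⟨d, Ψ, hd, fun u => LinearMap.ext fun x => ?_⟩
  obtain ⟨c, rfl⟩ := Ψ.surjective x
  rw [LinearEquiv.conj_apply, LinearMap.comp_apply, LinearMap.comp_apply, LinearEquiv.coe_coe, LinearEquiv.coe_coe,
    LinearEquiv.symm_apply_apply, ← hΨsmul]
  rfl

/-- **«`P_{A,α}(X) = ∏ P_{Lᵢ/k,α}(X)^{mᵢ}`, ALL `mᵢ = m`» ON `K`-POINTS, FOR EVERY `u ∈ K ⊗_ℚ F`: `P(ι_K(u) | K ⊗ V) = P(u· | K ⊗_ℚ F)^d`**,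
`d = dim_ℚ V/[F:ℚ]`, for EVERY field `K ⊇ ℚ` — `ι_K(u)` is conjugate to `diag(u·, …, u·)` on `(K ⊗ F)^d`.
[cite: Milne1999LefschetzClasses, §2 Prop. 2.1 proof, p. 647 L24–L36] [cite: Shimura1998, §5.1 Proposition 2] -/
theorem charpoly_baseChangeAction (u : K ⊗[ℚ] F) :
    (baseChangeAction K A.ι u).charpoly =
      (Algebra.lmul K (K ⊗[ℚ] F) u).charpoly ^ (Module.finrank ℚ V / Module.finrank ℚ F) := by
  obtain ⟨d, Ψ, hd, hconj⟩ := A.exists_conj_compLeft₅₇₆ K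
  rw [Nat.div_eq_of_eq_mul_left Module.finrank_pos hd.symm, hconj, LinearEquiv.charpoly_conj, charpoly_compLeft_eq_pow₅₇₆]
  rfl

/-- **`tr_K ι_K(u) = d · Tr_{(K ⊗ F)/K}(u)`** for every `u ∈ K ⊗_ℚ F` and every field `K ⊇ ℚ` («`tr(α) = m Tr(α)`» on `K`-points).
[cite: Shimura1998, §5.1 Proposition 2] [cite: Milne1999LefschetzClasses, §2 Prop. 2.1 proof, p. 647 L24–L36] -/
theorem trace_baseChangeAction (u : K ⊗[ℚ] F) :
    LinearMap.trace K (K ⊗[ℚ] V) (baseChangeAction K A.ι u) =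
      (Module.finrank ℚ V / Module.finrank ℚ F : ℕ) * Algebra.trace K (K ⊗[ℚ] F) u := by
  obtain ⟨d, Ψ, hd, hconj⟩ := A.exists_conj_compLeft₅₇₆ K
  rw [Nat.div_eq_of_eq_mul_left Module.finrank_pos hd.symm, hconj, LinearMap.trace_conj', trace_compLeft_eq_nsmul₅₇₆,
    nsmul_eq_mul, Algebra.trace_apply]
  rfl

/-- **`det_K ι_K(u) = N_{(K ⊗ F)/K}(u)^d`** for every `u ∈ K ⊗_ℚ F` and every field `K ⊇ ℚ` («`ν(α) = N(α)^m`» on `K`-points).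
[cite: Shimura1998, §5.1 Proposition 2] [cite: Milne1999LefschetzClasses, §2 Prop. 2.1 proof, p. 647 L24–L36] -/
theorem det_baseChangeAction (u : K ⊗[ℚ] F) :
    LinearMap.det (baseChangeAction K A.ι u) = Algebra.norm K u ^ (Module.finrank ℚ V / Module.finrank ℚ F) := by
  obtain ⟨d, Ψ, hd, hconj⟩ := A.exists_conj_compLeft₅₇₆ K
  rw [Nat.div_eq_of_eq_mul_left Module.finrank_pos hd.symm, hconj, LinearEquiv.conj_apply, LinearMap.comp_assoc,
    LinearMap.det_conj, det_compLeft_eq_pow₅₇₆, Algebra.norm_apply]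
  rfl

/-- **`P((ι a)_K | K ⊗ V) = P_{F/ℚ}(a)^d` IN `K[X]`** (`u = 1 ⊗ a`: `ι_K(1 ⊗ a) = (ι a)_K` and `charpoly_lmul_one_tmul`) — «`P_{A,α}` … is
equal to the characteristic polynomial of `V(α)` acting on the `k`-vector space `V(A)`». [cite: Milne1999LefschetzClasses, §2 Prop. 2.1 proof, p. 647 L24–L36] -/
theorem charpoly_baseChange_ι (a : F) :
    ((A.ι a).baseChange K).charpoly =
      ((Algebra.lmul ℚ F a).charpoly.map (algebraMap ℚ K)) ^ (Module.finrank ℚ V / Module.finrank ℚ F) := by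
  rw [← baseChangeAction_one_tmul K A.ι a, A.charpoly_baseChangeAction K, charpoly_lmul_one_tmul]

/-- `P((ι a)_K) = P(ι a)` mapped to `K[X]` (Mathlib `LinearMap.charpoly_baseChange`): the characteristic polynomial of `V(α)` on
`K ⊗ V` has coefficients in `ℚ`. [cite: Milne1999LefschetzClasses, §2 Prop. 2.1 proof, p. 647 L24–L27 («monic of degree 2 dim A with coefficients in ℚ»)] -/
theorem charpoly_baseChange_ι' (a : F) :
    ((A.ι a).baseChange K).charpoly = ((A.ι a).charpoly).map (algebraMap ℚ K) := by
  rw [LinearMap.charpoly_baseChange]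

/-- **The rational identity `P(ι a | V) = P_{F/ℚ}(a)^d` recovered in `K[X]`** from the `K ⊗ F`-route (both sides mapped by
`algebraMap ℚ K`; the tree's `EndAction.charpoly_ι` is the statement in `ℚ[X]`). [cite: Milne1999LefschetzClasses, §2 Prop. 2.1 proof, p. 647 L24–L36]
[cite: Shimura1998, §5.1 Proposition 2] -/
theorem charpoly_ι_map (a : F) :
    ((A.ι a).charpoly).map (algebraMap ℚ K) =
      ((Algebra.lmul ℚ F a).charpoly.map (algebraMap ℚ K)) ^ (Module.finrank ℚ V / Module.finrank ℚ F) := by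
  rw [← A.charpoly_baseChange_ι' K, A.charpoly_baseChange_ι K]

end EndAction

end HodgeStructure

end Literature.AlgebraicGeometry.Motives
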